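import Summits.QuantumAdvantage.QuantumAdvantage.Theorems.LinnikCubicClassGroupsDegreeOnePrimesEscapePerCharacterDeficitDensity
import Literature.NumberTheory.LFunctions.DedekindZetaExplicitFormula
import HarnessLib

/-!
# The log-free zero-density hypothesis for `ζ_K`, one field, in `Q`-form

Topic `Summits/QuantumAdvantage/QuantumAdvantage/Theorems`, helper for the stub
`stub_lowerPIT_of_density` (line `subgroup-orthogonality-escape`, crux `DegreeOnePrimesEscape`,
stmt-QuantumAdvantage-11543).

The stub's hypothesis is the log-free zero-density estimate for `ζ₁_K(s) = (s − 1)ζ_K(s)` of a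
number field of degree `n`, in the shape of the tree's `logFreeDensity_dedekindZeta₁`: a size
parameter `P ≥ 2` dominating `|d_K|`, `h_K`, `κ_K⁻¹` and the heights, and
`Σ_{ρ ∈ Z, β ≥ α} m(ρ) ≤ C_D P^{c_D(1−α)}`. Here we put `P = Q^a (T + 2)`, `Q = condQn K = |d_K| n^n`,
`a = max A 4`, for fields with `κ_K ≥ Q^{−A}` (`|d_K| ≤ Q`, `h_K ≤ Q⁴`; `sizeParam_admissible` of the
sibling file `…PerCharacterDeficitDensity`): `Σ_{ρ ∈ u, β ≥ α} m(ρ) ≤ C_D e^{c_D (a log Q + log(T + 4))(1−α)}`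
for every finite set `u` of zeros of `ζ₁_K` with `1/4 ≤ β < 1`, `|γ| ≤ T` (`T ≥ 1`, `α ≤ 1`) — the
shape consumed by `LinnikZeroSum.sum_rpow_div_le_of_density_zfr` (`lowerPIT_densityQ`).
-/

noncomputable section

open Complex Real
open scoped NumberField nonZeroDivisors
open Literature.NumberTheory.LFunctions Literature.NumberTheory.LFunctions.NumberField
  Literature.NumberTheory.LFunctions.LogFreeLocal

namespace Summit.QuantumAdvantage.QuantumAdvantage.Theorems.DegreeOnePrimesEscape

open scoped Classical in
/-- **The density hypothesis for `ζ₁_K`, one field, in `Q`-form.** From the log-free zero-density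
estimate for `ζ₁_K` in degree `n` (the stub's hypothesis), for every real `A`: with `a = max A 4`
and the SAME constants `c_D, C_D`, for every `K` of degree `n > 1` with `κ_K ≥ Q^{−A}`, `T ≥ 1`,
every finite set `u` of zeros of `ζ₁_K` with `1/4 ≤ β < 1`, `|γ| ≤ T`, and every `α ≤ 1`:
`Σ_{ρ ∈ u, β ≥ α} m(ρ) ≤ C_D e^{c_D(a log Q + log(T+4))(1−α)}`. -/
theorem lowerPIT_densityQ
    (hD : ∀ n : ℕ, ∃ c_D C_D : ℝ, 0 < c_D ∧ 0 < C_D ∧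
      ∀ (K : Type) [Field K] [NumberField K], Module.finrank ℚ K = n →
        ∀ P : ℝ, 2 ≤ P → ((NumberField.discr K).natAbs : ℝ) ≤ P →
          (Fintype.card (ClassGroup (𝓞 K)) : ℝ) ≤ P → P⁻¹ ≤ NumberField.dedekindZeta_residue K →
        ∀ Z : Finset ℂ, (∀ ρ ∈ Z, Literature.NumberTheory.LFunctions.dedekindZeta₁ K ρ = 0 ∧
            1 / 4 ≤ ρ.re ∧ ρ.re < 1 ∧ |ρ.im| ≤ P) →
          ∀ α : ℝ, 0 ≤ α → α ≤ 1 →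
            ∑ ρ ∈ Z with α ≤ ρ.re,
              (Literature.NumberTheory.LFunctions.LogFreeLocal.zeroOrder
                (Literature.NumberTheory.LFunctions.dedekindZeta₁ K) ρ : ℝ) ≤ C_D * P ^ (c_D * (1 - α)))
    (n : ℕ) (hn : 1 < n) (A : ℝ) :
    ∃ c_D C_D : ℝ, 0 < c_D ∧ 0 < C_D ∧
    ∀ (K : Type) [Field K] [NumberField K], Module.finrank ℚ K = n →
      ThornerZaman.condQn K ^ (-A) ≤ NumberField.dedekindZeta_residue K →
      ∀ T : ℝ, 1 ≤ T → ∀ u : Finset ℂ,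
        (∀ ρ ∈ u, dedekindZeta₁ K ρ = 0 ∧ 1 / 4 ≤ ρ.re ∧ ρ.re < 1 ∧ |ρ.im| ≤ T) →
        ∀ α : ℝ, α ≤ 1 →
          ∑ ρ ∈ u with α ≤ ρ.re, (analyticOrderNatAt (dedekindZeta₁ K) ρ : ℝ) ≤
            C_D * Real.exp (c_D * (max A 4 * Real.log (ThornerZaman.condQn K) + Real.log (T + 4))) ^ (1 - α) := by
  obtain ⟨c_D, C_D, hc, hC, hdens⟩ := hD n
  refine ⟨c_D, C_D, hc, hC, fun K _ _ hKn hκ T hT u hu α hα1 ↦ ?_⟩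
  have hK : 1 < Module.finrank ℚ K := by rw [hKn]; exact hn
  set a : ℝ := max A 4 with ha
  set Q : ℝ := ThornerZaman.condQn K with hQ
  have hQ12 : (12 : ℝ) ≤ Q := ThornerZaman.twelve_le_condQn (K := K) hK
  have hQ1 : (1 : ℝ) ≤ Q := by linarith
  set P : ℝ := Q ^ a * (T + 2) with hP
  obtain ⟨hP2, hdP, hhP, hκP, hTP⟩ :=
    sizeParam_admissible K hK (le_max_left _ _) (le_max_right _ _) hT hκ
  -- clamp `α` at `0`
  set α' : ℝ := max α 0 with hα'
  have hα'0 : 0 ≤ α' := le_max_right _ _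
  have hα'1 : α' ≤ 1 := max_le hα1 zero_le_one
  have hfilter : u.filter (fun ρ ↦ α ≤ ρ.re) = u.filter (fun ρ ↦ α' ≤ ρ.re) := by
    refine Finset.filter_congr fun ρ hρ ↦ ?_
    have := (hu ρ hρ).2.1
    rw [hα', max_le_iff]
    exact ⟨fun h ↦ ⟨h, by linarith⟩, fun h ↦ h.1⟩
  rw [hfilter]
  have huP : ∀ ρ ∈ u, dedekindZeta₁ K ρ = 0 ∧ 1 / 4 ≤ ρ.re ∧ ρ.re < 1 ∧ |ρ.im| ≤ P := by
    intro ρ hρ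
    obtain ⟨h0, h14, h1, hT'⟩ := hu ρ hρ
    exact ⟨h0, h14, h1, hT'.trans hTP⟩
  have key := hdens K hKn P hP2 hdP hhP hκP u huP α' hα'0 hα'1
  have key' : ∑ ρ ∈ u with α' ≤ ρ.re, (analyticOrderNatAt (dedekindZeta₁ K) ρ : ℝ) ≤
      C_D * P ^ (c_D * (1 - α')) := key
  refine key'.trans ?_
  -- `P^{c_D(1-α')} ≤ exp(c_D(a log Q + log(T+4)))^{1-α}`
  have hP1 : (1 : ℝ) ≤ P := by linarith
  have hQa0 : 0 < Q ^ a := Real.rpow_pos_of_pos (by linarith) _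
  have hPexp : P ≤ Real.exp (a * Real.log Q + Real.log (T + 4)) := by
    rw [Real.exp_add, Real.exp_log (by linarith), show a * Real.log Q = Real.log (Q ^ a) by
      rw [Real.log_rpow (by linarith)], Real.exp_log hQa0, hP]
    nlinarith
  set B : ℝ := Real.exp (c_D * (a * Real.log Q + Real.log (T + 4))) with hBdef
  have h1α : 0 ≤ 1 - α' := by linarith
  have hαα : 1 - α' ≤ 1 - α := by rw [hα']; exact sub_le_sub_left (le_max_left _ _) _
  have hB1 : 1 ≤ B := Real.one_le_exp (by
    have : 0 ≤ Real.log Q := Real.log_nonneg hQ1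
    have : 0 ≤ Real.log (T + 4) := Real.log_nonneg (by linarith)
    have : 0 ≤ a := le_trans (by norm_num) (le_max_right A 4)
    positivity)
  have hpow : P ^ (c_D * (1 - α')) ≤ B ^ (1 - α) := by
    calc P ^ (c_D * (1 - α')) = (P ^ c_D) ^ (1 - α') := by rw [Real.rpow_mul (by linarith)]
      _ ≤ (Real.exp (a * Real.log Q + Real.log (T + 4)) ^ c_D) ^ (1 - α') :=
          Real.rpow_le_rpow (by positivity) (Real.rpow_le_rpow (by linarith) hPexp hc.le) h1α
      _ = B ^ (1 - α') := by rw [hBdef, ← Real.exp_mul]; ring_nf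
      _ ≤ B ^ (1 - α) := Real.rpow_le_rpow_of_exponent_le hB1 hαα
  exact mul_le_mul_of_nonneg_left hpow hC.le

/-- Closed form of `lowerPIT_densityQ`: the registered sub-goal of the stub `stub_lowerPIT_of_density`
proved by this file. -/
theorem lowerPIT_density : ∀ (hD : ∀ n : ℕ, ∃ c_D C_D : ℝ, 0 < c_D ∧ 0 < C_D ∧
      ∀ (K : Type) [Field K] [NumberField K], Module.finrank ℚ K = n →
        ∀ P : ℝ, 2 ≤ P → ((NumberField.discr K).natAbs : ℝ) ≤ P →
          (Fintype.card (ClassGroup (𝓞 K)) : ℝ) ≤ P → P⁻¹ ≤ NumberField.dedekindZeta_residue K →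
        ∀ Z : Finset ℂ, (∀ ρ ∈ Z, Literature.NumberTheory.LFunctions.dedekindZeta₁ K ρ = 0 ∧
            1 / 4 ≤ ρ.re ∧ ρ.re < 1 ∧ |ρ.im| ≤ P) →
          ∀ α : ℝ, 0 ≤ α → α ≤ 1 →
            ∑ ρ ∈ Z with α ≤ ρ.re,
              (Literature.NumberTheory.LFunctions.LogFreeLocal.zeroOrder
                (Literature.NumberTheory.LFunctions.dedekindZeta₁ K) ρ : ℝ) ≤ C_D * P ^ (c_D * (1 - α)))
    (n : ℕ) (hn : 1 < n) (A : ℝ),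
    ∃ c_D C_D : ℝ, 0 < c_D ∧ 0 < C_D ∧
    ∀ (K : Type) [Field K] [NumberField K], Module.finrank ℚ K = n →
      ThornerZaman.condQn K ^ (-A) ≤ NumberField.dedekindZeta_residue K →
      ∀ T : ℝ, 1 ≤ T → ∀ u : Finset ℂ,
        (∀ ρ ∈ u, dedekindZeta₁ K ρ = 0 ∧ 1 / 4 ≤ ρ.re ∧ ρ.re < 1 ∧ |ρ.im| ≤ T) →
        ∀ α : ℝ, α ≤ 1 →
          ∑ ρ ∈ u with α ≤ ρ.re, (analyticOrderNatAt (dedekindZeta₁ K) ρ : ℝ) ≤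
            C_D * Real.exp (c_D * (max A 4 * Real.log (ThornerZaman.condQn K) + Real.log (T + 4))) ^ (1 - α) :=
  @lowerPIT_densityQ

end Summit.QuantumAdvantage.QuantumAdvantage.Theorems.DegreeOnePrimesEscape

end
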